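import Literature.NumberTheory.Automorphic.JacquetLanglands
import Literature.NumberTheory.Automorphic.UnramifiedHeckeScalarsFlathProofs
import HarnessLib

/-!
# Spherical Hecke operators at a split place act by scalars on automorphic representations of `D^×`

Topic `NumberTheory/Automorphic`; theorems only (no definition, no named fact). The quaternionic
twin of `Flath1979_heckeOperatorAt_sphericalLevelAt_eq_smul_holds`
(`UnramifiedHeckeScalarsFlathProofs`, for cuspidal representations of `GL_n(𝔸_K)`): for a
finite-dimensional `K`-algebra `D` (a quaternion algebra in the application), an irreducible
closed subrepresentation `πD ≤ L²(D_𝔸ˣ ⧸ ℝ_{>0} Dˣ)` (`DiscreteAutomorphicRep`), a finite place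
`v` with an identification `e : D_vˣ ≃* GL_n(K_v)` and `g ∈ GL_n(K_v)`, the double-coset
operator `[K'_v ι(g) K'_v]` — `K'_v = sphericalLevelAtD v e` the transported `GL_n(𝒪_v)` placed
at `v`, `ι = Quat.ofLocal ∘ e⁻¹ : GL_n(K_v) ↪ D_𝔸ˣ` — acts on the `K'_v`-fixed vectors of `πD`
by a scalar (`heckeOperatorAt_sphericalLevelAtD_eq_smul`). This is the second layer of the
bridge between local components and Satake parameters for the Jacquet–Langlands files
(`JacquetLanglands`, `JacquetLanglandsParts`): it makes the `D`-side Satake parameters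
(`HasSatakeParameterAtD`) well defined and lets a Satake eigenvector of `πD` generate an
irreducible smooth representation of `GL_n(K_v) ≅ D_vˣ` (`SphericalVectorIrreducible`).

## Proof

Exactly the abstract Gelfand–Schur theorem `exists_heckeOperator_eq_smul_of_isTopIrreducible`
of `UnramifiedHeckeScalarsFlathProofs` (unitary irreducible `πD` on a Hilbert space;
`G = Λ · C` with `Λ = ι(GL_n(K_v))`, `C = {c | c_v = 1}` centralising `Λ`; finite double cosets;
commuting Hecke operators by Gelfand's trick for `(GL_n(K_v), GL_n(𝒪_v))` through `g ↦ (g⁻¹)ᵀ`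
and the Cartan decomposition), fed with the structure of `D_𝔸ˣ = (𝔸_K ⊗_K D)ˣ` proved here:

* `Quat.algebraMap_adeleSingleHom_one_mul`: multiplication by the central idempotent
  `ε_v = e_v ⊗ 1` of `𝔸_K ⊗ D` is "project to `v`, re-embed": `ε_v · y = ι_v(y_v)`
  (checked on pure tensors; Vignéras, LNM 800, III §1; Weil, *Basic Number Theory*, IX §1);
* `Quat.ofLocal_mul_eq_mul_ofLocal_of_toCompletionUnits_eq_one`: an element of `D_𝔸ˣ` with
  trivial `v`-component commutes with `ι_v(D_vˣ)` (write `ι_v(t) = 1 + T`, `c = 1 + C` with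
  `ε_v T = T`, `ε_v C = 0`, whence `TC = CT = 0`; Jacquet–Langlands, LNM 114, §14: `D_𝔸ˣ` is the
  restricted product of the `D_wˣ`);
* `Quat.toCompletionUnits_ofLocal_inv_mul`: `D_𝔸ˣ = ι_v(D_vˣ) · ker(x ↦ x_v)`.

No continuity of `e` is needed: everything is algebraic except unitarity and irreducibility
of `πD`, which come from `L²`.

## References

* H. Jacquet, R. P. Langlands, *Automorphic forms on GL(2)*, LNM 114 (1970), §14
  [JacquetLanglands1970].
* S. Gelbart, *Automorphic forms on adele groups* (1975), §10 [Gelbart1975].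
* M.-F. Vignéras, *Arithmétique des algèbres de quaternions*, LNM 800 (1980), Ch. III §1
  [VignerasLNM800].
* P. Cartier, *Representations of 𝔭-adic groups*, Corvallis (1979), §IV [CartierCorvallis1979];
  A. Deitmar, S. Echterhoff, *Principles of harmonic analysis* (2014), Thm. 11.2.4
  [DeitmarEchterhoff2014].
-/

noncomputable section

open scoped TensorProduct MatrixGroups
open NumberField IsDedekindDomain MeasureTheory

universe u

namespace Literature.NumberTheory.Automorphic

/-! ### Structure of `D_𝔸ˣ` around one finite place -/

section Structure

variable (K : Type) [Field K] [NumberField K] (D : Type u) [Ring D] [Algebra K D]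
  (v : HeightOneSpectrum (𝓞 K))

/-- **Multiplication by the idempotent `ε_v = e_v ⊗ 1` of `𝔸_K ⊗ D` is the projection onto the
`v`-factor**: `ε_v · y = ι_v(y_v)`, where `e_v = adeleSingleHom K v 1`, `y_v` is the image of
`y` in `D_v = K_v ⊗ D` and `ι_v = Quat.localToAdelic` the factor inclusion (on pure tensors this
is `e_v a ⊗ x = ι_v(a_v) ⊗ x`, `adeleSingleHom_one_mul`; Vignéras, LNM 800, III §1; Weil,
*Basic Number Theory*, IX §1). [folklore] -/
theorem Quat.algebraMap_adeleSingleHom_one_mul (y : ScalarExtension K (AdeleRing (𝓞 K) K) D) :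
    algebraMap (AdeleRing (𝓞 K) K) (ScalarExtension K (AdeleRing (𝓞 K) K) D)
        (adeleSingleHom K v 1) * y =
      Quat.localToAdelic K D v (ScalarExtension.mapLeft K D (adeleEvalAlgHom K v) y) := by
  change (LinearMap.mulLeft K (algebraMap (AdeleRing (𝓞 K) K)
      (ScalarExtension K (AdeleRing (𝓞 K) K) D) (adeleSingleHom K v 1))) y =
    ((Quat.localToAdelicLinear K D v).comp
      (ScalarExtension.mapLeft K D (adeleEvalAlgHom K v)).toLinearMap) y
  congr 1
  refine TensorProduct.ext' fun a x => ?_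
  change algebraMap (AdeleRing (𝓞 K) K) (ScalarExtension K (AdeleRing (𝓞 K) K) D)
      (adeleSingleHom K v 1) * ScalarExtension.ofTensor K _ D (a ⊗ₜ[K] x) =
    Quat.localToAdelicLinear K D v
      (ScalarExtension.mapLeft K D (adeleEvalAlgHom K v) (ScalarExtension.ofTensor K _ D (a ⊗ₜ[K] x)))
  rw [ScalarExtension.mapLeft_tmul]
  change (adeleSingleHom K v 1 ⊗ₜ[K] (1 : D)) * (a ⊗ₜ[K] x) =
    Quat.localToAdelicLinear K D v (adeleEvalAlgHom K v a ⊗ₜ[K] x)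
  rw [Quat.localToAdelicLinear_tmul, Algebra.TensorProduct.tmul_mul_tmul, one_mul,
    adeleSingleHom_one_mul]
  rfl

variable {K D v} in
/-- **An element of `D_𝔸ˣ` with trivial `v`-component commutes with the image of `D_vˣ`** under
the local embedding `Quat.ofLocal`: writing `ι_v(t) = 1 + T`, `c = 1 + C` with `ε_v T = T`
(`T` is supported at `v`) and `ε_v C = 0` (`C` vanishes at `v`) for the central idempotent
`ε_v = e_v ⊗ 1`, one gets `TC = CT = 0` (Jacquet–Langlands, LNM 114, §14: `D_𝔸ˣ` is the
restricted product of the `D_wˣ`; the `GL_n` version is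
`GLn.ofLocal_mul_eq_mul_ofLocal_of_toLocal_eq_one`). [folklore] -/
theorem Quat.ofLocal_mul_eq_mul_ofLocal_of_toCompletionUnits_eq_one (t : completionUnits D v)
    {c : adelicUnits K D} (hc : toCompletionUnits K D v c = 1) :
    Quat.ofLocal K D v t * c = c * Quat.ofLocal K D v t := by
  refine Units.ext ?_
  set ε : ScalarExtension K (AdeleRing (𝓞 K) K) D :=
    algebraMap (AdeleRing (𝓞 K) K) (ScalarExtension K (AdeleRing (𝓞 K) K) D)
      (adeleSingleHom K v 1) with hε
  set T : ScalarExtension K (AdeleRing (𝓞 K) K) D :=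
    (Quat.ofLocal K D v t : ScalarExtension K (AdeleRing (𝓞 K) K) D) - 1 with hT
  set C : ScalarExtension K (AdeleRing (𝓞 K) K) D :=
    (c : ScalarExtension K (AdeleRing (𝓞 K) K) D) - 1 with hC
  have hT' : T = Quat.localToAdelic K D v ((t : ScalarExtension K (v.adicCompletion K) D) - 1) := by
    rw [hT, Quat.coe_ofLocal, add_sub_cancel_left]
  have heT : ε * T = T := by
    rw [hT', hε, Quat.algebraMap_adeleSingleHom_one_mul, Quat.mapLeft_localToAdelic]
  have hc' : ScalarExtension.mapLeft K D (adeleEvalAlgHom K v)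
      (c : ScalarExtension K (AdeleRing (𝓞 K) K) D) = 1 := by
    change ((toCompletionUnits K D v c : completionUnits D v) :
      ScalarExtension K (v.adicCompletion K) D) = 1
    rw [hc, Units.val_one]
  have heC : ε * C = 0 := by
    rw [hε, Quat.algebraMap_adeleSingleHom_one_mul, hC, map_sub, hc', map_one, sub_self,
      map_zero]
  have hεT : ε * T = T * ε := Algebra.commutes _ _
  have hεC : ε * C = C * ε := Algebra.commutes _ _
  have hTC : T * C = 0 := by
    calc T * C = ε * T * C := by rw [heT]
      _ = T * (ε * C) := by rw [hεT, mul_assoc]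
      _ = 0 := by rw [heC, mul_zero]
  have hCT : C * T = 0 := by
    calc C * T = C * (ε * T) := by rw [heT]
      _ = ε * C * T := by rw [← mul_assoc, hεC]
      _ = 0 := by rw [heC, zero_mul]
  have h1 : (Quat.ofLocal K D v t : ScalarExtension K (AdeleRing (𝓞 K) K) D) = 1 + T := by
    rw [hT, add_sub_cancel]
  have h2 : (c : ScalarExtension K (AdeleRing (𝓞 K) K) D) = 1 + C := by
    rw [hC, add_sub_cancel]
  rw [Units.val_mul, Units.val_mul, h1, h2, add_mul, one_mul, mul_add, mul_one, hTC, add_zero,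
    add_mul, one_mul, mul_add, mul_one, hCT, add_zero, add_right_comm]

variable {K D v} in
/-- **`D_𝔸ˣ = ι_v(D_vˣ) · {c | c_v = 1}`**: for every `x ∈ D_𝔸ˣ`, `l = ι_v(x_v)` satisfies
`(l⁻¹ x)_v = 1` (`Quat.toCompletionUnits_ofLocal`; Jacquet–Langlands, LNM 114, §14). [folklore] -/
theorem Quat.toCompletionUnits_ofLocal_inv_mul [Module.Finite K D] (x : adelicUnits K D) :
    toCompletionUnits K D v ((Quat.ofLocal K D v (toCompletionUnits K D v x))⁻¹ * x) = 1 := by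
  rw [map_mul, map_inv, Quat.toCompletionUnits_ofLocal, inv_mul_cancel]

end Structure

/-! ### The transported spherical level and Hecke elements -/

section Transport

variable {K : Type} [Field K] [NumberField K] {D : Type u} [Ring D] [Algebra K D]
  [Module.Finite K D] {n : ℕ} (v : HeightOneSpectrum (𝓞 K))
  (e : completionUnits D v ≃* GL (Fin n) (v.adicCompletion K))

/-- The transported spherical level `sphericalLevelAtD v e` is the image of `GL_n(𝒪_v)` under
the embedding `ι = Quat.ofLocal ∘ e⁻¹ : GL_n(K_v) →* D_𝔸ˣ` (`Subgroup.map_map`). [folklore] -/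
theorem sphericalLevelAtD_eq_map_comp :
    sphericalLevelAtD v e =
      (valuedCongruenceSubgroup (Fin n) (1 : WithZero (Multiplicative ℤ))).map
        ((Quat.ofLocal K D v).comp e.symm.toMonoidHom) := by
  rw [sphericalLevelAtD, Subgroup.map_map]
  rfl

/-- The transported Hecke element `heckeDiagAtD v e ϖ i` is `ι(diag(ϖ,…,ϖ,1,…,1))` for
`ι = Quat.ofLocal ∘ e⁻¹` (definitional). [folklore] -/
theorem heckeDiagAtD_eq_comp_apply (ϖ : (v.adicCompletion K)ˣ) (i : ℕ) :
    heckeDiagAtD v e ϖ i = ((Quat.ofLocal K D v).comp e.symm.toMonoidHom) (heckeDiag n ϖ i) :=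
  rfl

omit [Module.Finite K D] in
/-- The embedding `ι = Quat.ofLocal ∘ e⁻¹ : GL_n(K_v) →* D_𝔸ˣ` is injective. [folklore] -/
theorem Quat.ofLocal_comp_symm_injective :
    Function.Injective ((Quat.ofLocal K D v).comp e.symm.toMonoidHom) :=
  Quat.ofLocal_injective.comp e.symm.injective

/-- Every double coset of the transported spherical level `K'_v = sphericalLevelAtD v e` through
an element of `ι(GL_n(K_v))` is a finite union of left cosets (transport of
`finite_orbit_valuedCongruenceSubgroup_one` along the injective `ι`). [folklore] -/
theorem finite_orbit_sphericalLevelAtD (g : GL (Fin n) (v.adicCompletion K)) :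
    (MulAction.orbit (sphericalLevelAtD v e)
      (QuotientGroup.mk (((Quat.ofLocal K D v).comp e.symm.toMonoidHom) g) :
        (AdelicGroupData.units K D).Adelic ⧸ sphericalLevelAtD v e)).Finite := by
  rw [sphericalLevelAtD_eq_map_comp]
  exact finite_orbit_map _ (Quat.ofLocal_comp_symm_injective v e) _ g
    (finite_orbit_valuedCongruenceSubgroup_one n K v g)

end Transport

/-! ### The scalar action -/

section Scalars

variable {K : Type} [Field K] [NumberField K] {D : Type u} [Ring D] [Algebra K D]
  [Module.Finite K D]
  {μ_D : Measure (AdelicGroupData.units K D).automorphicQuotient}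
  [(AdelicGroupData.units K D).IsAutomorphicMeasure μ_D]

/-- **The spherical Hecke algebra at a split place acts by scalars on an automorphic
representation of `D^×`.** Let `πD` be an irreducible closed subrepresentation of
`L²(D_𝔸ˣ ⧸ ℝ_{>0} Dˣ)`, `v` a finite place, `e : D_vˣ ≃* GL_n(K_v)` an identification (in the
application induced by an algebra splitting `D_v ≃ₐ M₂(K_v)`), `ι = Quat.ofLocal ∘ e⁻¹` and
`K'_v = ι(GL_n(𝒪_v))` (`sphericalLevelAtD v e`). Then for every `g ∈ GL_n(K_v)` the Hecke
operator `[K'_v ι(g) K'_v]` acts on `πD^{K'_v}` by a scalar. Proof: the abstract Gelfand–Schur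
theorem `exists_heckeOperator_eq_smul_of_isTopIrreducible` for the unitary irreducible `πD`,
`Λ = ι(GL_n(K_v))`, `C = ker(x ↦ x_v)` (`Quat.ofLocal_mul_eq_mul_ofLocal_of_toCompletionUnits_eq_one`,
`Quat.toCompletionUnits_ofLocal_inv_mul`), finite double cosets (`finite_orbit_sphericalLevelAtD`)
and the commutativity of the Hecke operators of `(GL_n(K_v), GL_n(𝒪_v))` acting through `ι`
(`heckeOperator_comm_of_mulEquiv` with `g ↦ (g⁻¹)ᵀ`, `heckeOperator_map_apply_eq`) — the
`GL_n` argument of `Flath1979_heckeOperatorAt_sphericalLevelAt_eq_smul_holds` verbatim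
(Flath, Corvallis (1979), Thm. 3, and Gelbart (1975), §10, for the printed tensor-product route;
Cartier, Corvallis (1979), §IV; Deitmar–Echterhoff (2014), Thm. 11.2.4).
[cite: DeitmarEchterhoff2014, Thm. 11.2.4 (pp. 266–267)] [cite: FlathCorvallis1979, Thm. 3] -/
theorem heckeOperatorAt_sphericalLevelAtD_eq_smul
    (πD : DiscreteAutomorphicRep (AdelicGroupData.units K D) μ_D) {n : ℕ}
    {v : HeightOneSpectrum (𝓞 K)} (e : completionUnits D v ≃* GL (Fin n) (v.adicCompletion K))
    (g : GL (Fin n) (v.adicCompletion K)) :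
    ∃ c : ℂ, ∀ f ∈ πD.space.fixedVectors (sphericalLevelAtD v e),
      heckeOperatorAt πD.space (sphericalLevelAtD v e) (Quat.ofLocal K D v (e.symm g)) f = c • f := by
  classical
  let ι : GL (Fin n) (v.adicCompletion K) →* (AdelicGroupData.units K D).Adelic :=
    (Quat.ofLocal K D v).comp e.symm.toMonoidHom
  have hιinj : Function.Injective ι := Quat.ofLocal_comp_symm_injective v e
  let K₀ : Subgroup (GL (Fin n) (v.adicCompletion K)) :=
    valuedCongruenceSubgroup (Fin n) (1 : WithZero (Multiplicative ℤ))
  have hK : sphericalLevelAtD v e = K₀.map ι := sphericalLevelAtD_eq_map_comp v e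
  let π := πD.space.toContRep
  have hU : π.IsUnitary :=
    ClosedSubrep.isUnitary_toContRep ((AdelicGroupData.units K D).isUnitary_rightRegular μ_D)
      πD.space
  have hirr : π.IsTopIrreducible := πD.irreducible
  let Λ : Subgroup (AdelicGroupData.units K D).Adelic := ι.range
  let C : Subgroup (AdelicGroupData.units K D).Adelic := ((AdelicGroupData.units K D).toLocal v).ker
  have hKΛ : sphericalLevelAtD v e ≤ Λ := by
    rw [hK]
    exact Subgroup.map_le_range ι K₀
  have hC : ∀ c ∈ C, ∀ x ∈ Λ, c * x = x * c := by
    rintro c hc _ ⟨t, rfl⟩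
    exact (Quat.ofLocal_mul_eq_mul_ofLocal_of_toCompletionUnits_eq_one (e.symm t)
      ((MonoidHom.mem_ker).1 hc)).symm
  have hgen : ∀ x : (AdelicGroupData.units K D).Adelic, ∃ l ∈ Λ, l⁻¹ * x ∈ C := fun x =>
    ⟨ι (e (toCompletionUnits K D v x)), ⟨_, rfl⟩, by
      rw [MonoidHom.mem_ker]
      have : ι (e (toCompletionUnits K D v x)) =
          Quat.ofLocal K D v (toCompletionUnits K D v x) := by
        change Quat.ofLocal K D v (e.symm (e (toCompletionUnits K D v x))) = _
        rw [MulEquiv.symm_apply_apply]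
      rw [this]
      exact Quat.toCompletionUnits_ofLocal_inv_mul x⟩
  have hfin₀ := finite_orbit_valuedCongruenceSubgroup_one n K v
  have hfin : ∀ l ∈ Λ, (MulAction.orbit (sphericalLevelAtD v e)
      (l : (AdelicGroupData.units K D).Adelic ⧸ sphericalLevelAtD v e)).Finite := by
    rintro _ ⟨t, rfl⟩
    rw [hK]
    exact finite_orbit_map ι hιinj K₀ t (hfin₀ t)
  obtain ⟨τ, hτ⟩ := exists_mulEquiv_coe_eq_transpose_inv (n := Fin n) (F := v.adicCompletion K)
  have hcomm : ∀ l ∈ Λ, ∀ l' ∈ Λ,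
      ∀ w ∈ π.toRepresentation.fixedPoints (sphericalLevelAtD v e),
        heckeOperator π.toRepresentation (sphericalLevelAtD v e) l
            (heckeOperator π.toRepresentation (sphericalLevelAtD v e) l' w) =
          heckeOperator π.toRepresentation (sphericalLevelAtD v e) l'
            (heckeOperator π.toRepresentation (sphericalLevelAtD v e) l w) := by
    rintro _ ⟨t, rfl⟩ _ ⟨t', rfl⟩ w hw
    rw [hK] at hw ⊢
    have key : ∀ (s : GL (Fin n) (v.adicCompletion K)) (u : πD.space.toSubmodule),
        u ∈ π.toRepresentation.fixedPoints (K₀.map ι) →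
          heckeOperator π.toRepresentation (K₀.map ι) (ι s) u =
            heckeOperator (π.toRepresentation.comp ι) K₀ s u :=
      fun s u hu => heckeOperator_map_apply_eq ι hιinj K₀ π.toRepresentation s (hfin₀ s) hu
    have hfin' : ∀ s : GL (Fin n) (v.adicCompletion K),
        (MulAction.orbit (K₀.map ι) (ι s : (AdelicGroupData.units K D).Adelic ⧸ K₀.map ι)).Finite :=
      fun s => finite_orbit_map ι hιinj K₀ s (hfin₀ s)
    have hwt : heckeOperator π.toRepresentation (K₀.map ι) (ι t) w ∈
        π.toRepresentation.fixedPoints (K₀.map ι) :=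
      heckeOperator_apply_mem_fixedPoints _ _ _ hw (hfin' t)
    have hwt' : heckeOperator π.toRepresentation (K₀.map ι) (ι t') w ∈
        π.toRepresentation.fixedPoints (K₀.map ι) :=
      heckeOperator_apply_mem_fixedPoints _ _ _ hw (hfin' t')
    change heckeOperator π.toRepresentation (K₀.map ι) (ι t)
        (heckeOperator π.toRepresentation (K₀.map ι) (ι t') w) =
      heckeOperator π.toRepresentation (K₀.map ι) (ι t')
        (heckeOperator π.toRepresentation (K₀.map ι) (ι t) w)
    rw [key t _ hwt', key t' _ hw, key t' _ hwt, key t _ hw]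
    have hw₀ : (w : πD.space.toSubmodule) ∈
        Representation.fixedPoints (π.toRepresentation.comp ι) K₀ := by
      rw [Representation.mem_fixedPoints] at hw ⊢
      exact fun k hk => hw (ι k) ⟨k, hk, rfl⟩
    exact heckeOperator_comm_of_mulEquiv K₀ (π.toRepresentation.comp ι) τ
      (mulEquiv_apply_mem_valuedCongruenceSubgroup_one_iff τ hτ)
      (mulEquiv_apply_mem_doubleCoset_inv τ hτ) hfin₀ t t' hw₀
  obtain ⟨c, hc⟩ := exists_heckeOperator_eq_smul_of_isTopIrreducible π hU hirr hKΛ hC hgen hfin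
    hcomm (l := ι g) ⟨g, rfl⟩
  exact ⟨c, fun f hf => hc f hf⟩

/-- Pointwise form at the transported Hecke elements: for a uniformizer datum `ϖ` and `i`, the
operator `T^D_{v,i} = [K'_v t^D_{v,i} K'_v]` (`heckeDiagAtD`) acts on `πD^{K'_v}` by a scalar
(`heckeOperatorAt_sphericalLevelAtD_eq_smul` at `g = diag(ϖ,…,ϖ,1,…,1)`). [folklore] -/
theorem heckeOperatorAt_heckeDiagAtD_eq_smul
    (πD : DiscreteAutomorphicRep (AdelicGroupData.units K D) μ_D) {n : ℕ}
    {v : HeightOneSpectrum (𝓞 K)} (e : completionUnits D v ≃* GL (Fin n) (v.adicCompletion K))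
    (ϖ : (v.adicCompletion K)ˣ) (i : ℕ) :
    ∃ c : ℂ, ∀ f ∈ πD.space.fixedVectors (sphericalLevelAtD v e),
      heckeOperatorAt πD.space (sphericalLevelAtD v e) (heckeDiagAtD v e ϖ i) f = c • f :=
  heckeOperatorAt_sphericalLevelAtD_eq_smul πD e (heckeDiag n ϖ i)

end Scalars

end Literature.NumberTheory.Automorphic
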